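import Literature.MathematicalPhysics.QuantumFieldTheory.Balaban1983to89.Node00.BgSchemePrOfRecord
import HarnessLib

/-!
# NODE 00 — `BgSchemeChartLinLie`: THE LIE-ALGEBRA READING OF THE (47)-CARRYING [B11] PROP. 6 CHART — «U = U′U₀, U′ = exp(iηA)»,
# `A = T_V(A′ + 𝔄)` the linearizing transformation (47) applied to the small field; THE SEAM (s-exp)ᵀ AT A FLAT BACKGROUND; THE FLAT VALUE;
# Cⁿ-DEPENDENCE OF THE (47)-CARRYING CHART ENTRIES ALONG A DATUM MAP

Cell `pub-ymgap` (YM-PLAN Track A), seat `pub-ymgap-node00-def-Y` (g41; custodian of the `BgScheme` instance of record; Node00 definition lane;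
count-neutral, `--supports stmt-QuantumFields-27238`).  ★★★ director-ym №629∕№630∕№631 (4): «(C) continuation» of the Node00 edition of record
past the G-door — file (C1), GENERIC over the scheme `S` and the (47)-slot `T`; ◆ CRIT-1 (nodeO 2026-08-31 (A4) CUT): «a named Lie exponent
`BgScheme.lieExpoLinAt S T V A b := Complex.I • S.ev (T V (A + S.𝔄 V)) b` with `expoLinAt = exp ∘ lieExpoLinAt` (`rfl`) and `lieExpoLinAt_id`».
[B11] = [Balaban1985Variational] (CMP **102** (1985) 277–309).

WHAT.  ✓`Node00.BgSchemePrOfRecord` §1 typed, for an abstract Prop. 6 scheme `S : BgScheme F N 𝒴 𝒵 K k` and a (47)-slot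
`T : fields → 𝒴 → 𝒴` («`A = A′ − HD(A′)`», (47) p.285, carried as a letter), the (47)-CARRYING chart `S.chartLin T V A`,
`(chartLin T V A)(b) = exp(i·ev(T_V(A + 𝔄V))(b)) · U₀(b)`, its value at the fixed point `S.chartCfgLin T V` and the Lie token `S.LieLinTokAt T V`
(«`i·ev(T_V(𝒜V + 𝔄V))(b) ∈ 𝔰𝔲(N)` on every bond»); the (47)-free letters of ✓`Node00.BackgroundMapOfRecord` are the case `T := fun _ => id` (`rfl`).
This file is the (47)-carrying twin of ✓`Node00.BgSchemeChartLie` §1 and §3: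
* §1 THE LIE READING AND THE SEAM — ◆'s matrix-valued Lie exponent `S.lieExpoLinAt T V A b = i·ev(T_V(A + 𝔄V))(b)` (`expoLinAt = exp ∘ lieExpoLinAt`,
  `rfl`); the `𝔰𝔲(N)`-valued reading AT THE FIXED POINT `S.lieExpoLin T V : bonds → 𝔰𝔲(N)` through the real-linear retraction `suProj N` (the K0 tangent
  socket's `X`; `lieExpoLin (fun _ => id) = lieExpo`, `rfl`); transparency under the token (`coe_lieExpoLin`); and ★ `chartCfgLin_eq_expChart_one`: at a
  FLAT background `U₀ = bg V = 1` the (47)-carrying chart image of the fixed point IS the exponential chart at `1` of its Lie reading,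
  `S.chartCfgLin T V = expChart 1 (S.lieExpoLin T V)` — the seam (s-exp)ᵀ — with its eventual form along any datum map.
* §2 THE FLAT VALUE — zero small field (`𝒜(V) = 0`, `𝔄(V) = 0`) AND `T_V(0) = 0` give zero Lie reading, the Lie token, unit exponent and
  `chartCfgLin T V = bg V`; the vanishing `T_V(0) = 0` of (47) at zero is DISPLAYED (`hT0`) — at the record it is lit ✓`B11Eq90V0GroupComposed.T47_zero`
  under the Sect. C regime, which this generic file never sees.
* §3 REGULARITY — Cⁿ-dependence of `x ↦ S.lieExpoLin T (u x)`, of the exponent and of the chart matrix entries `x ↦ (S.chartCfgLin T (u x))(b)` along a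
  datum map `u : E → fields`, from Cⁿ-dependence of the TRANSFORMED full small field `x ↦ T_{u x}(𝒜(u x) + 𝔄(u x))` (at the record: Prop. 9's
  analyticity of `𝒜`, `𝔄` composed with Prop. 3's analyticity of (47), lit ✓`analyticOnNhd_T47`) and continuity of the presentation `ev`; plus the
  bookkeeping shape of a `V`-constant slot `T := fun _ => τ` (the record's `linPrOfRecord`).

WHY.  The K0ᴬ box road re-keys its doors onto the (47)-carrying chart of record (★★★ №618 (3)(b), R727-ym: `chartCfg_unitField_eventuallyEq_expChart_ofRecord`,
`contDiffAt_lieExpo_unitField_ofRecord_of_exp_mem`, …); those consume exactly (s-exp), `chartCfg 1 = 1` and the Cⁿ chart entries, which this file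
supplies GENERICALLY for `chartLin T`, so that the framed scheme of record (✓`bgSchemePrOfRecord … 𝔥 …` with `T := linPrOfRecord …`) and any other
instance read them by name (the record-side specialisations are file (C3) `Node00.BgSchemePrOfRecordLie`).

HONEST.  Definitions with bodies and lemmas proved from them; the printed laws stay DISPLAYED (`LieLinTokAt`, `hT0 : T V 0 = 0`, the regime at `V`,
the Cⁿ premise); nothing of [B11] is asserted; no `sorry`, no new axiom, no instance ∕ notation; no edit of any landed file.  Finite torus, fixed
`ε`: nothing here is a claim about the Yang–Mills mass gap (`Summit.QuantumFields`) — NOT continuum ∕ OS ∕ Clay.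
-/

noncomputable section

namespace Literature.MathematicalPhysics.QuantumFieldTheory.Balaban1983to89.Node00

open _root_.Filter _root_.Topology
open scoped Matrix.Norms.L2Operator
open T4Continuum (T4Family)
open T4AdjointCovarianceUnitary (lieSU expSU coe_expSU mem_lieSU_iff exp_mem_specialUnitaryGroup_of_mem_lieSU)
open B11Eq174Chart (Regime solA)
open NormedSpace (exp)

namespace BgScheme

variable {F : T4Family} {N : ℕ} {𝒴 𝒵 : Type} [NormedAddCommGroup 𝒴] [NormedSpace ℂ 𝒴] [NormedAddCommGroup 𝒵] [NormedSpace ℂ 𝒵] {K k : ℕ}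
variable (S : BgScheme F N 𝒴 𝒵 K k) (T : GaugeField (F.P K) k (SU N) → 𝒴 → 𝒴)

/-! ## §1. The Lie reading of the (47)-carrying exponent and the seam with the exponential chart at `1` -/

/-- **THE (47)-CARRYING LIE EXPONENT, MATRIX FORM** (◆'s letter): `lieExpoLinAt S T V A b = i·ev(T_V(A + 𝔄V))(b)`, so that «U′ = exp(iηA)» reads
`expoLinAt = exp ∘ lieExpoLinAt` (`rfl`). [cite: Balaban1985Variational, (15) p.280, (47) p.285, (74) p.289] -/
def lieExpoLinAt (V : GaugeField (F.P K) k (SU N)) (A : 𝒴) (b : PBond (F.P K) 0) : Matrix (Fin N) (Fin N) ℂ :=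
  Complex.I • S.ev (T V (A + S.𝔄 V)) b

/-- `expoLinAt = exp ∘ lieExpoLinAt` (`rfl`). [cite: Balaban1985Variational, (15) p.280, (47) p.285] -/
theorem expoLinAt_eq_exp_lieExpoLinAt (V : GaugeField (F.P K) k (SU N)) (A : 𝒴) (b : PBond (F.P K) 0) :
    S.expoLinAt T V A b = exp (S.lieExpoLinAt T V A b) := rfl

/-- The (47)-free Lie exponent is the case `T := id`: `lieExpoLinAt (fun _ => id) V A b = i·ev(A + 𝔄V)(b)` (`rfl`). [cite: Balaban1985Variational, (15) p.280 (bookkeeping)] -/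
theorem lieExpoLinAt_id (V : GaugeField (F.P K) k (SU N)) (A : 𝒴) (b : PBond (F.P K) 0) :
    S.lieExpoLinAt (fun _ => id) V A b = Complex.I • S.ev (A + S.𝔄 V) b := rfl

/-- The Lie exponent at the fixed point, unfolded. [cite: Balaban1985Variational, Prop. 6 (116) p.295 (bookkeeping)] -/
theorem lieExpoLinAt_sol (V : GaugeField (F.P K) k (SU N)) (b : PBond (F.P K) 0) :
    S.lieExpoLinAt T V (S.sol V) b = Complex.I • S.ev (T V (S.sol V + S.𝔄 V)) b := rfl

/-- **THE (47)-CARRYING EXPONENT READ IN `𝔰𝔲(N)` AT THE FIXED POINT**: `lieExpoLin S T V b = π(i·ev(T_V(𝒜V + 𝔄V))(b))` through the real-linear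
retraction `π = suProj N` (identity on `𝔰𝔲(N)`) — the (47)-carrying twin of ✓`BgScheme.lieExpo`, the K0 tangent socket's `X`; on `LieLinTokAt`'s fields it
IS `i·ev(T_V(𝒜V + 𝔄V))(b)` (`coe_lieExpoLin`). [cite: Balaban1985Variational, (15) p.280, (19) p.281, (47) p.285] -/
def lieExpoLin (V : GaugeField (F.P K) k (SU N)) (b : PBond (F.P K) 0) : lieSU (Fin N) :=
  suProj N (S.lieExpoLinAt T V (S.sol V) b)

/-- Unfolding of `lieExpoLin`. [cite: Balaban1985Variational, (15) p.280 (bookkeeping)] -/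
theorem lieExpoLin_apply (V : GaugeField (F.P K) k (SU N)) (b : PBond (F.P K) 0) :
    S.lieExpoLin T V b = suProj N (Complex.I • S.ev (T V (S.sol V + S.𝔄 V)) b) := rfl

/-- The (47)-free Lie reading is the case `T := id`: `lieExpoLin (fun _ => id) = lieExpo` (`rfl`). [cite: Balaban1985Variational, (15) p.280 (bookkeeping)] -/
theorem lieExpoLin_id : S.lieExpoLin (fun _ => id) = S.lieExpo := rfl

/-- Under the token the Lie reading is transparent: the matrix of `lieExpoLin S T V b` is `i·ev(T_V(𝒜V + 𝔄V))(b)`. [cite: Balaban1985Variational, (15) p.280, (47) p.285] -/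
theorem coe_lieExpoLin {V : GaugeField (F.P K) k (SU N)} (h : S.LieLinTokAt T V) (b : PBond (F.P K) 0) :
    ((S.lieExpoLin T V b : lieSU (Fin N)) : Matrix (Fin N) (Fin N) ℂ) = Complex.I • S.ev (T V (S.sol V + S.𝔄 V)) b :=
  coe_suProj_of_mem (h b)

/-- Under the token: the matrix of `lieExpoLin` is the matrix Lie exponent at the fixed point. [cite: Balaban1985Variational, (15) p.280 (bookkeeping)] -/
theorem coe_lieExpoLin_eq_lieExpoLinAt_sol {V : GaugeField (F.P K) k (SU N)} (h : S.LieLinTokAt T V) (b : PBond (F.P K) 0) :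
    ((S.lieExpoLin T V b : lieSU (Fin N)) : Matrix (Fin N) (Fin N) ℂ) = S.lieExpoLinAt T V (S.sol V) b :=
  S.coe_lieExpoLin T h b

/-- Under the token the exponent at the fixed point is the exponential of the Lie reading. [cite: Balaban1985Variational, (15) p.280, (47) p.285] -/
theorem expoLinAt_sol_eq_exp_coe_lieExpoLin {V : GaugeField (F.P K) k (SU N)} (h : S.LieLinTokAt T V) (b : PBond (F.P K) 0) :
    S.expoLinAt T V (S.sol V) b = exp ((S.lieExpoLin T V b : lieSU (Fin N)) : Matrix (Fin N) (Fin N) ℂ) := by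
  rw [S.coe_lieExpoLin T h b]
  rfl

/-- Under the token `exp(i·ev(T_V(𝒜V + 𝔄V))(b))`, read in `SU(N)`, is `expSU` of the Lie reading. [cite: Balaban1985Variational, (15) p.280, (47) p.285] -/
theorem suOfMat_expoLinAt_sol_eq_expSU {V : GaugeField (F.P K) k (SU N)} (h : S.LieLinTokAt T V) (b : PBond (F.P K) 0) :
    suOfMat N (S.expoLinAt T V (S.sol V) b) = expSU (S.lieExpoLin T V b) := by
  rw [suOfMat_of_mem (S.expoLinAt_sol_mem_of_lieLinTokAt T h b)]
  exact Subtype.ext (S.expoLinAt_sol_eq_exp_coe_lieExpoLin T h b)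

/-- Under the token the matrix of the (47)-carrying chart image is `exp(lieExpoLin(b)) · U₀(b)`. [cite: Balaban1985Variational, (15) p.280, (47) p.285] -/
theorem coe_chartCfgLin_of_lieLinTokAt {V : GaugeField (F.P K) k (SU N)} (h : S.LieLinTokAt T V) (b : PBond (F.P K) 0) :
    ((S.chartCfgLin T V b : SU N) : Matrix (Fin N) (Fin N) ℂ) =
      exp ((S.lieExpoLin T V b : lieSU (Fin N)) : Matrix (Fin N) (Fin N) ℂ) * ((S.bg V b : SU N) : Matrix (Fin N) (Fin N) ℂ) := by
  rw [← S.chartLin_sol T, S.coe_chartLin_of_mem T (S.expoLinAt_sol_mem_of_lieLinTokAt T h b), S.expoLinAt_sol_eq_exp_coe_lieExpoLin T h b]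

section Seam

variable [NeZero N]

/-- **★ THE SEAM «(s-exp)ᵀ» AT A FLAT BACKGROUND**: if `U₀ = bg V = 1` and the (47)-carrying exponent is `𝔰𝔲(N)`-valued, the chart image of the fixed
point IS the exponential chart at `1` of its Lie reading: `S.chartCfgLin T V = expChart 1 (S.lieExpoLin T V)` («U = U′U₀ = exp(iηA)» at `U₀ = 1`,
`A = T_V(𝒜V + 𝔄V)`). [cite: Balaban1985Variational, (15) p.280, (19) p.281, (47) p.285] -/
theorem chartCfgLin_eq_expChart_one {V : GaugeField (F.P K) k (SU N)} (hbg : S.bg V = 1) (h : S.LieLinTokAt T V) :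
    S.chartCfgLin T V = expChart 1 (S.lieExpoLin T V) := by
  funext b
  show suOfMat N (S.expoLinAt T V (S.sol V) b) * S.bg V b = (1 : GaugeField (F.P K) 0 (SU N)) b * expSU (S.lieExpoLin T V b)
  rw [S.suOfMat_expoLinAt_sol_eq_expSU T h b, hbg, show (1 : GaugeField (F.P K) 0 (SU N)) b = 1 from rfl, mul_one, one_mul]

/-- (s-exp)ᵀ, matrix form at a flat background: `(chartCfgLin T V)(b) = exp(lieExpoLin(b))`. [cite: Balaban1985Variational, (15) p.280, (47) p.285] -/
theorem coe_chartCfgLin_of_lieLinTokAt_of_bg_eq_one {V : GaugeField (F.P K) k (SU N)} (hbg : S.bg V = 1) (h : S.LieLinTokAt T V)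
    (b : PBond (F.P K) 0) :
    ((S.chartCfgLin T V b : SU N) : Matrix (Fin N) (Fin N) ℂ) = exp ((S.lieExpoLin T V b : lieSU (Fin N)) : Matrix (Fin N) (Fin N) ℂ) := by
  rw [S.coe_chartCfgLin_of_lieLinTokAt T h b, hbg, show (1 : GaugeField (F.P K) 0 (SU N)) b = 1 from rfl, OneMemClass.coe_one, mul_one]

/-- **(s-exp)ᵀ ALONG A DATUM MAP, eventual form**: for a datum map `u` into flat-background fields (`bg (u x) = 1`) on which the Lie token holds
eventually along a filter `l`, the (47)-carrying chart family IS eventually the exponential-chart family of the Lie readings: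
`S.chartCfgLin T ∘ u =ᶠ[l] (x ↦ expChart 1 (S.lieExpoLin T (u x)))` — the form the K0 tangent socket consumes (the germ at the flat datum).
[cite: Balaban1985Variational, (15) p.280, (19) p.281, (47) p.285] -/
theorem chartCfgLin_comp_eventuallyEq_expChart {E : Type*} {l : Filter E} {u : E → GaugeField (F.P K) k (SU N)}
    (hbg : ∀ x, S.bg (u x) = 1) (h : ∀ᶠ x in l, S.LieLinTokAt T (u x)) :
    (fun x => S.chartCfgLin T (u x)) =ᶠ[l] fun x => expChart 1 (S.lieExpoLin T (u x)) :=
  h.mono fun x hx => S.chartCfgLin_eq_expChart_one T (hbg x) hx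

/-- (s-exp)ᵀ along a datum map, pointwise form under the token everywhere. [cite: Balaban1985Variational, (15) p.280, (47) p.285] -/
theorem chartCfgLin_comp_eq_expChart {E : Type*} {u : E → GaugeField (F.P K) k (SU N)}
    (hbg : ∀ x, S.bg (u x) = 1) (h : ∀ x, S.LieLinTokAt T (u x)) :
    (fun x => S.chartCfgLin T (u x)) = fun x => expChart 1 (S.lieExpoLin T (u x)) :=
  funext fun x => S.chartCfgLin_eq_expChart_one T (hbg x) (h x)

end Seam

/-! ## §2. The flat value of the (47)-carrying letters -/

/-- **ZERO SMALL FIELD AND `T_V(0) = 0` ⟹ ZERO LIE EXPONENT** at the fixed point (the vanishing of (47) at zero, `HD(0) = 0`, is DISPLAYED as `hT0`;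
at the record it is lit ✓`T47_zero` under the Sect. C regime). [cite: Balaban1985Variational, (15) p.280, (47) p.285, (55) p.286] -/
theorem lieExpoLinAt_sol_eq_zero {V : GaugeField (F.P K) k (SU N)} (hsol : S.sol V = 0) (h𝔄 : S.𝔄 V = 0) (hT0 : T V 0 = 0)
    (b : PBond (F.P K) 0) : S.lieExpoLinAt T V (S.sol V) b = 0 := by
  rw [lieExpoLinAt_sol, hsol, h𝔄, add_zero, hT0, map_zero, Pi.zero_apply, smul_zero]

/-- Zero small field and `T_V(0) = 0` ⟹ zero Lie reading. [cite: Balaban1985Variational, (15) p.280, (47) p.285] -/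
theorem lieExpoLin_eq_zero {V : GaugeField (F.P K) k (SU N)} (hsol : S.sol V = 0) (h𝔄 : S.𝔄 V = 0) (hT0 : T V 0 = 0) :
    S.lieExpoLin T V = 0 := by
  funext b
  rw [lieExpoLin, S.lieExpoLinAt_sol_eq_zero T hsol h𝔄 hT0 b, map_zero, Pi.zero_apply]

/-- Zero small field and `T_V(0) = 0` ⟹ the Lie token holds (trivially: `0 ∈ 𝔰𝔲(N)`). [cite: Balaban1985Variational, (15) p.280, (47) p.285] -/
theorem lieLinTokAt_of_sol_eq_zero {V : GaugeField (F.P K) k (SU N)} (hsol : S.sol V = 0) (h𝔄 : S.𝔄 V = 0) (hT0 : T V 0 = 0) :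
    S.LieLinTokAt T V := by
  intro b
  rw [← lieExpoLinAt_sol, S.lieExpoLinAt_sol_eq_zero T hsol h𝔄 hT0 b]
  exact Submodule.zero_mem _

/-- Zero small field and `T_V(0) = 0` ⟹ unit exponent `exp(i·0) = 1` at the fixed point. [cite: Balaban1985Variational, (15) p.280, (47) p.285] -/
theorem expoLinAt_sol_eq_one {V : GaugeField (F.P K) k (SU N)} (hsol : S.sol V = 0) (h𝔄 : S.𝔄 V = 0) (hT0 : T V 0 = 0)
    (b : PBond (F.P K) 0) : S.expoLinAt T V (S.sol V) b = 1 := by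
  rw [expoLinAt_eq_exp_lieExpoLinAt, S.lieExpoLinAt_sol_eq_zero T hsol h𝔄 hT0 b, NormedSpace.exp_zero]

/-- **★ ZERO SMALL FIELD AND `T_V(0) = 0` ⟹ THE (47)-CARRYING CHART IMAGE IS THE BACKGROUND**: `chartCfgLin T V = bg V` («U = U′U₀» with `U′ = 1`);
at the flat record datum (`U₀ = 1`, `J(1) = 0`, `𝔄(1) = 0`, `T₁(0) = 0`) this is the junction's `chartCfgLin T 1 = 1`.
[cite: Balaban1985Variational, (15) p.280, (47) p.285, Prop. 9 p.309] -/
theorem chartCfgLin_eq_bg {V : GaugeField (F.P K) k (SU N)} (hsol : S.sol V = 0) (h𝔄 : S.𝔄 V = 0) (hT0 : T V 0 = 0) :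
    S.chartCfgLin T V = S.bg V := by
  funext b
  rw [← chartLin_sol, chartLin_apply, S.expoLinAt_sol_eq_one T hsol h𝔄 hT0 b,
    ← OneMemClass.coe_one (Matrix.specialUnitaryGroup (Fin N) ℂ : Submonoid _)]
  show suOfMat N (((1 : SU N)) : Matrix (Fin N) (Fin N) ℂ) * S.bg V b = S.bg V b
  rw [suOfMat_coe, one_mul]

/-- Flat data under the regime and `T_V(0) = 0` ⟹ the (47)-carrying chart image is the background. [cite: Balaban1985Variational, (15) p.280, (47) p.285, Prop. 9 p.309] -/
theorem chartCfgLin_eq_bg_of_regime [CompleteSpace 𝒴] {V : GaugeField (F.P K) k (SU N)}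
    (R : Regime (S.𝒢 V) 0 (S.W V) S.B₀ 0 S.C₄ S.a₃ S.j S.a S.ε₄) (hj : 0 ≤ S.j) (ha : 0 < S.a) (hJ : S.J V = 0) (h𝔄 : S.𝔄 V = 0)
    (hT0 : T V 0 = 0) : S.chartCfgLin T V = S.bg V :=
  S.chartCfgLin_eq_bg T (sol_eq_zero R hj ha hJ h𝔄) h𝔄 hT0

/-! ## §3. Regularity of the (47)-carrying chart entries along a datum map -/

section Regularity

variable {E : Type*} [NormedAddCommGroup E] [NormedSpace ℝ E]

/-- **Cⁿ OF THE LIE READING ALONG A DATUM MAP**: if the TRANSFORMED full small field `x ↦ T_{u x}(𝒜(u x) + 𝔄(u x))` is `Cⁿ` at `x₀` (print: analytic —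
Prop. 9 with Prop. 3's analyticity of (47)) and the presentation is continuous, `x ↦ lieExpoLin S T (u x)` is `Cⁿ` at `x₀`.
[cite: Balaban1985Variational, Prop. 9 p.309, Prop. 3 p.289, (15) p.280, (47) p.285] -/
theorem contDiffAt_lieExpoLin_comp {n : WithTop ℕ∞} (hev : Continuous S.ev) {u : E → GaugeField (F.P K) k (SU N)} {x₀ : E}
    (hd : ContDiffAt ℝ n (fun x => T (u x) (S.sol (u x) + S.𝔄 (u x))) x₀) :
    ContDiffAt ℝ n (fun x => S.lieExpoLin T (u x)) x₀ := by
  have hev' : ContDiffAt ℝ n (fun x => S.ev (T (u x) (S.sol (u x) + S.𝔄 (u x)))) x₀ :=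
    ((S.evR hev).contDiff.contDiffAt).comp x₀ hd
  refine contDiffAt_pi.2 fun b => ?_
  have hb : ContDiffAt ℝ n (fun x => S.ev (T (u x) (S.sol (u x) + S.𝔄 (u x))) b) x₀ := contDiffAt_pi.1 hev' b
  have hI : ContDiffAt ℝ n (fun x => Complex.I • S.ev (T (u x) (S.sol (u x) + S.𝔄 (u x))) b) x₀ := hb.const_smul Complex.I
  exact ((suProj N).contDiff.contDiffAt).comp x₀ hI

/-- Differentiability of the Lie reading along a datum map (the `C¹` case). [cite: Balaban1985Variational, Prop. 9 p.309, (15) p.280, (47) p.285] -/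
theorem differentiableAt_lieExpoLin_comp (hev : Continuous S.ev) {u : E → GaugeField (F.P K) k (SU N)} {x₀ : E}
    (hd : ContDiffAt ℝ 1 (fun x => T (u x) (S.sol (u x) + S.𝔄 (u x))) x₀) :
    DifferentiableAt ℝ (fun x => S.lieExpoLin T (u x)) x₀ :=
  (S.contDiffAt_lieExpoLin_comp T hev hd).differentiableAt one_ne_zero

/-- **Cⁿ OF THE (47)-CARRYING EXPONENT ALONG A DATUM MAP**: `x ↦ exp(i·ev(T_{u x}(𝒜 + 𝔄)(u x))(b))` is `Cⁿ` at `x₀` under the same premises.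
[cite: Balaban1985Variational, Prop. 9 p.309, (15) p.280, (47) p.285] -/
theorem contDiffAt_expoLinAt_sol_comp {n : WithTop ℕ∞} (hev : Continuous S.ev) {u : E → GaugeField (F.P K) k (SU N)} {x₀ : E}
    (hd : ContDiffAt ℝ n (fun x => T (u x) (S.sol (u x) + S.𝔄 (u x))) x₀) (b : PBond (F.P K) 0) :
    ContDiffAt ℝ n (fun x => S.expoLinAt T (u x) (S.sol (u x)) b) x₀ := by
  have hev' : ContDiffAt ℝ n (fun x => S.ev (T (u x) (S.sol (u x) + S.𝔄 (u x)))) x₀ :=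
    ((S.evR hev).contDiff.contDiffAt).comp x₀ hd
  have hI : ContDiffAt ℝ n (fun x => Complex.I • S.ev (T (u x) (S.sol (u x) + S.𝔄 (u x))) b) x₀ :=
    (contDiffAt_pi.1 hev' b).const_smul Complex.I
  exact (contDiffAt_exp_matrix _).comp x₀ hI

/-- **★ Cⁿ OF THE (47)-CARRYING CHART MATRIX ENTRIES ALONG A DATUM MAP**: for a datum map `u` into fields with a CONSTANT background `bg (u x) = U₀` on
which the Lie token holds near `x₀`, and a `Cⁿ` transformed full small field, `x ↦ (chartCfgLin T (u x))(b) = exp(i·ev(T(𝒜 + 𝔄))(b))·U₀(b)` is `Cⁿ` at `x₀`.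
[cite: Balaban1985Variational, Prop. 9 p.309, (15) p.280, (47) p.285] -/
theorem contDiffAt_coe_chartCfgLin_comp {n : WithTop ℕ∞} (hev : Continuous S.ev) {u : E → GaugeField (F.P K) k (SU N)} {x₀ : E}
    {U₀ : GaugeField (F.P K) 0 (SU N)} (hbg : ∀ x, S.bg (u x) = U₀) (htok : ∀ᶠ x in 𝓝 x₀, S.LieLinTokAt T (u x))
    (hd : ContDiffAt ℝ n (fun x => T (u x) (S.sol (u x) + S.𝔄 (u x))) x₀) (b : PBond (F.P K) 0) :
    ContDiffAt ℝ n (fun x => ((S.chartCfgLin T (u x) b : SU N) : Matrix (Fin N) (Fin N) ℂ)) x₀ := by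
  have heq : (fun x => ((S.chartCfgLin T (u x) b : SU N) : Matrix (Fin N) (Fin N) ℂ)) =ᶠ[𝓝 x₀]
      fun x => S.expoLinAt T (u x) (S.sol (u x)) b * ((U₀ b : SU N) : Matrix (Fin N) (Fin N) ℂ) :=
    htok.mono fun x hx =>
      show ((S.chartCfgLin T (u x) b : SU N) : Matrix (Fin N) (Fin N) ℂ) = S.expoLinAt T (u x) (S.sol (u x)) b * ((U₀ b : SU N) : Matrix (Fin N) (Fin N) ℂ) by
        rw [← S.chartLin_sol T, S.coe_chartLin_of_mem T (S.expoLinAt_sol_mem_of_lieLinTokAt T hx b), hbg x]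
  exact ((S.contDiffAt_expoLinAt_sol_comp T hev hd b).mul contDiffAt_const).congr_of_eventuallyEq heq

/-- The (47)-carrying chart matrix entries as ONE map into bond-indexed matrices are `Cⁿ` at `x₀` (the shape `hC`∕`hdiff` of the K0 junction).
[cite: Balaban1985Variational, Prop. 9 p.309, (15) p.280, (47) p.285] -/
theorem contDiffAt_coe_chartCfgLin_comp_pi {n : WithTop ℕ∞} (hev : Continuous S.ev) {u : E → GaugeField (F.P K) k (SU N)} {x₀ : E}
    {U₀ : GaugeField (F.P K) 0 (SU N)} (hbg : ∀ x, S.bg (u x) = U₀) (htok : ∀ᶠ x in 𝓝 x₀, S.LieLinTokAt T (u x))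
    (hd : ContDiffAt ℝ n (fun x => T (u x) (S.sol (u x) + S.𝔄 (u x))) x₀) :
    ContDiffAt ℝ n (fun x (b : PBond (F.P K) 0) => ((S.chartCfgLin T (u x) b : SU N) : Matrix (Fin N) (Fin N) ℂ)) x₀ :=
  contDiffAt_pi.2 fun b => S.contDiffAt_coe_chartCfgLin_comp T hev hbg htok hd b

/-- Differentiability of the (47)-carrying chart matrix entries along a datum map (the `C¹` case; the junction's `hdiff`).
[cite: Balaban1985Variational, Prop. 9 p.309, (15) p.280, (47) p.285] -/
theorem differentiableAt_coe_chartCfgLin_comp_pi (hev : Continuous S.ev) {u : E → GaugeField (F.P K) k (SU N)} {x₀ : E}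
    {U₀ : GaugeField (F.P K) 0 (SU N)} (hbg : ∀ x, S.bg (u x) = U₀) (htok : ∀ᶠ x in 𝓝 x₀, S.LieLinTokAt T (u x))
    (hd : ContDiffAt ℝ 1 (fun x => T (u x) (S.sol (u x) + S.𝔄 (u x))) x₀) :
    DifferentiableAt ℝ (fun x (b : PBond (F.P K) 0) => ((S.chartCfgLin T (u x) b : SU N) : Matrix (Fin N) (Fin N) ℂ)) x₀ :=
  (S.contDiffAt_coe_chartCfgLin_comp_pi T hev hbg htok hd).differentiableAt one_ne_zero

/-- **THE `V`-CONSTANT (47)-SLOT** (the record's `linPrOfRecord … := fun _ => T47 …`): if `τ` is `Cⁿ` at the full small field `𝒜(u x₀) + 𝔄(u x₀)` and the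
full small field `x ↦ 𝒜(u x) + 𝔄(u x)` is `Cⁿ` at `x₀`, the transformed full small field for the slot `T := fun _ => τ` is `Cⁿ` at `x₀` (chain rule; the
premise `hd` of the lemmas above, in the slot's own spelling). [cite: Balaban1985Variational, Prop. 9 p.309, Prop. 3 p.289, (47) p.285] -/
theorem contDiffAt_constSlot_sol_add_shift_comp {n : WithTop ℕ∞} {τ : 𝒴 → 𝒴} {u : E → GaugeField (F.P K) k (SU N)} {x₀ : E}
    (hτ : ContDiffAt ℝ n τ (S.sol (u x₀) + S.𝔄 (u x₀))) (hd₀ : ContDiffAt ℝ n (fun x => S.sol (u x) + S.𝔄 (u x)) x₀) :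
    ContDiffAt ℝ n (fun x => (fun _ : GaugeField (F.P K) k (SU N) => τ) (u x) (S.sol (u x) + S.𝔄 (u x))) x₀ :=
  hτ.comp x₀ hd₀

end Regularity

end BgScheme

end Literature.MathematicalPhysics.QuantumFieldTheory.Balaban1983to89.Node00
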